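import Summits.QuantumAdvantage.AdviceFreeQNC0.AffBells22FrameAffine
import Summits.QuantumAdvantage.AdviceFreeQNC0.AffBells22FibreSumJunta
import Summits.QuantumAdvantage.AdviceFreeQNC0.AffBells23Transversal
import HarnessLib

/-!
# Sketch22 §2c: `FrameAveraging` (all junta widths) and the rung `RingFrameJuntaLt3`, proved

* `norm_twist_sum_le_junta` — THE FROZEN TWIST BOUND for junta tables: for frozen tables `y_k` reading `T_k`, a frequency `γ`
  and a transversal `A ⊆ supp γ` of `(T_k)`, `‖Σ_{x odd} (−1)^{⟨J(x), stake(y,x)⟩} ω^{⟨γ,x⟩}‖ ≤ (200/39)(39/40)^{|A|} 2^{N−1}`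
  (per-fibre JPD bound `norm_fibre_twist_le_junta` + the mixed hard-core word potential `total_le_two_mixed`);
* `norm_errorTerm_le_junta` — the frame-averaging error term at frequency `t` is at most `(200/39)(39/40)^{|A|} 2^{N−1}` for every
  transversal `A ⊆ supp(tV)`;
* `exists_frame_transversal` — a `δ`-regular frame and `w₀`-junta tables admit, for every `t ≠ 0`, a transversal inside `supp(tV)`
  of size `≥ δ²N/(δ + w₀²)` (Turán / Caro–Wei, `AffBells23.exists_transversal_ge`);
* **`frameAveraging : FrameAveraging`** (Sketch22 §2c, THE domination theorem, all `w₀`): `μ₀ = δ'·log(40/39)/(2·log 3)`,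
  `δ' = δ²/(δ + w₀²)`; NO Viola–Wigderson / `Mod3VsLowDegree` input — LEMMA JPD (planner qn-p1 g23, `AffBells23JuntaProduct`)
  replaces it;
* **`ringFrameJuntaLt3 : RingFrameJuntaLt3`** — the rung R-frame ⊗ junta, unconditionally (`ringFrameJuntaLt3_of`, i.e. frame
  averaging + `juntaHardOfTwo` + the tree theorem `ringHardOdd_two`).

Separation NOT moved; nothing here touches the crux `RingDenseResidualLt3` directly (the rung covers regime (I) + EXIT over regular
frames of ROUND-21 §4.7).
-/

namespace Summit.QuantumAdvantage.AdviceFreeQNC0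

open Finset Literature.Computability.QuantumComplexity Literature.Computability.QuantumComplexity.RingHLF
open Literature.Computability.MetaComplexity

namespace AffBells22

variable {N m : ℕ}

/-! ## The frozen twist bound for junta tables -/

/-- **THE FROZEN TWIST BOUND, JUNTA TABLES**: for frozen tables `y_k` reading `T_k`, a frequency `γ` and a transversal `A ⊆ supp γ` of
`(T_k)`, `‖Σ_{x odd} (−1)^{⟨J(x), stake(y,x)⟩} ω^{⟨γ,x⟩}‖ ≤ (200/39)·(39/40)^{|A|}·2^{N−1}`. -/
theorem norm_twist_sum_le_junta (hN : 3 ≤ N) (T : Fin N → Finset (Fin N)) (y : Fin N → (Fin N → Bool) → Bool)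
    (hy : ∀ k, ReadsOnly (T k) (y k)) (γ : Fin N → ZMod 3) (A : Finset (Fin N))
    (hA : ∀ k, (T k ∩ A).card ≤ 1) (hAγ : ∀ i ∈ A, γ i ≠ 0) :
    ‖∑ x ∈ (univ : Finset (Fin N → Bool)).filter (fun x => Fib19.IsOdd x),
        (-1 : ℂ) ^ dot2 (Fib19.kline x) (Fib19.stake (fun x k => y k x) x)
          * (ZMod.stdAddChar (∑ i : Fin N, if x i then γ i else 0) : ℂ)‖
      ≤ 200 / 39 * (39 / 40 : ℝ) ^ A.card * (2 : ℝ) ^ (N - 1) := by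
  obtain ⟨m, rfl⟩ : ∃ m, N = m + 1 := ⟨N - 1, by omega⟩
  set γR : Fin (m + 1) → ZMod 3 := fun i => if i ∈ A then γ i else 0 with hγR
  set O := (univ : Finset (Fin (m + 1) → Bool)).filter (fun x => Fib19.IsOdd x) with hO
  set Φ : (Fin (m + 1) → Bool) → ℂ := fun x => (-1 : ℂ) ^ dot2 (Fib19.kline x) (Fib19.stake (fun x k => y k x) x)
      * (ZMod.stdAddChar (∑ i : Fin (m + 1), if x i then γ i else 0) : ℂ) with hΦ
  have hmaps : ∀ x ∈ O, Fib19.kline x ∈ O.image Fib19.kline := fun x hx => mem_image_of_mem _ hx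
  rw [← sum_fiberwise_of_maps_to hmaps]
  have hfib : ∀ J ∈ O.image Fib19.kline,
      ‖∑ x ∈ O.filter (fun x => Fib19.kline x = J), Φ x‖ ≤ wordWt (wtGamma γR) J := by
    intro J hJ
    obtain ⟨x₀, hx₀, rfl⟩ := mem_image.mp hJ
    exact norm_fibre_twist_le_junta hN (mem_filter.mp hx₀).2 T y hy γ A hA
  have hsub : O.image Fib19.kline ⊆ univ.filter (fun v : Fin (m + 1) → Bool => NoAdj v) := by
    intro J hJ
    obtain ⟨x₀, hx₀, rfl⟩ := mem_image.mp hJ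
    exact mem_filter.mpr ⟨mem_univ _, noAdj_of_hardCore (Fib19.kline_hardCore hN x₀ (mem_filter.mp hx₀).2)⟩
  set D := univ.filter fun i : Fin (m + 1) => γR i ≠ 0 with hD
  have hDA : D = A := by
    ext i
    simp only [hD, hγR, mem_filter, mem_univ, true_and]
    constructor
    · intro h
      by_contra hi
      exact h (by simp [hi])
    · intro hi
      simp [hi, hAγ i hi]
  have h3 := total_le_two_mixed (wtGamma γR) (wtGamma_nonneg γR) (wtGamma_le_two γR) (D.map Fin.valEmbedding)
    (fun i hi => wtGamma_le_of_mem γR i hi) m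
  have hκ := kappa_pow_le (card_supp_le_filter_succ D)
  rw [Nat.add_sub_cancel, ← hDA]
  have h2q : (0 : ℝ) ≤ 2 ^ m := by positivity
  calc ‖∑ J ∈ O.image Fib19.kline, ∑ x ∈ O.filter (fun x => Fib19.kline x = J), Φ x‖
      ≤ ∑ J ∈ O.image Fib19.kline, ‖∑ x ∈ O.filter (fun x => Fib19.kline x = J), Φ x‖ := norm_sum_le _ _
    _ ≤ ∑ J ∈ O.image Fib19.kline, wordWt (wtGamma γR) J := sum_le_sum hfib
    _ ≤ ∑ v : Fin (m + 1) → Bool, (if NoAdj v then wordWt (wtGamma γR) v else 0) := by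
        rw [← sum_filter]
        exact sum_le_sum_of_subset_of_nonneg hsub (fun v _ _ => wordWt_nonneg (wtGamma_nonneg γR) v)
    _ ≤ _ := h3
    _ ≤ 5 * ((40 / 39) * (39 / 40 : ℝ) ^ D.card) * 2 ^ m := by gcongr
    _ = 200 / 39 * (39 / 40 : ℝ) ^ D.card * 2 ^ m := by ring

/-! ## The error term for junta tables -/

/-- **THE ERROR TERM AT FREQUENCY `t`, JUNTA TABLES**: for every transversal `A ⊆ supp(tV)` of the reading sets,
`‖Σ_{x odd} Ĝ_x(t) ω^{⟨t,Vx⟩}‖ ≤ (200/39)·(39/40)^{|A|}·2^{N−1}`. -/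
theorem norm_errorTerm_le_junta (hN : 3 ≤ N) (V : Fin m → Fin N → ZMod 3) (T : Fin N → Finset (Fin N))
    (τ : Fin N → (Fin m → ZMod 3) → (Fin N → Bool) → Bool)
    (hτ : ∀ k y, ReadsOnly (T k) (τ k y)) (t : Fin m → ZMod 3) (A : Finset (Fin N))
    (hA : ∀ k, (T k ∩ A).card ≤ 1) (hAγ : ∀ i ∈ A, (∑ l : Fin m, t l * V l i) ≠ 0) :
    ‖∑ x ∈ (univ : Finset (Fin N → Bool)).filter (fun x => Fib19.IsOdd x),
        fhat m (frozenSign τ x) t * (ZMod.stdAddChar (∑ l : Fin m, t l * frameVal V x l) : ℂ)‖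
      ≤ 200 / 39 * (39 / 40 : ℝ) ^ A.card * (2 : ℝ) ^ (N - 1) := by
  set γ : Fin N → ZMod 3 := fun i => ∑ l : Fin m, t l * V l i with hγ
  set O := (univ : Finset (Fin N → Bool)).filter (fun x => Fib19.IsOdd x) with hO
  set S : (Fin m → ZMod 3) → ℂ := fun u =>
    ∑ x ∈ O, (-1 : ℂ) ^ dot2 (Fib19.kline x) (Fib19.stake (fun x k => τ k u x) x)
      * (ZMod.stdAddChar (∑ i : Fin N, if x i then γ i else 0) : ℂ) with hS
  have hL : ∀ x ∈ O, fhat m (frozenSign τ x) t * (ZMod.stdAddChar (∑ l : Fin m, t l * frameVal V x l) : ℂ)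
      = ∑ u : Fin m → ZMod 3, ((3 : ℂ) ^ m)⁻¹ * ((ZMod.stdAddChar (-(∑ i : Fin m, t i * u i)) : ℂ) *
          ((-1 : ℂ) ^ dot2 (Fib19.kline x) (Fib19.stake (fun x k => τ k u x) x)
            * (ZMod.stdAddChar (∑ i : Fin N, if x i then γ i else 0) : ℂ))) := by
    intro x _
    unfold fhat
    rw [mul_sum, sum_mul]
    refine sum_congr rfl fun u _ => ?_
    rw [sum_mul_frameVal]
    unfold frozenSign frozenBell
    ring
  have hexp : ∑ x ∈ O, fhat m (frozenSign τ x) t * (ZMod.stdAddChar (∑ l : Fin m, t l * frameVal V x l) : ℂ)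
      = ((3 : ℂ) ^ m)⁻¹ * ∑ u : Fin m → ZMod 3, (ZMod.stdAddChar (-(∑ i : Fin m, t i * u i)) : ℂ) * S u := by
    rw [sum_congr rfl hL, sum_comm, mul_sum]
    refine sum_congr rfl fun u _ => ?_
    rw [hS, mul_sum, mul_sum]
  have hin : ∀ u : Fin m → ZMod 3, ‖(ZMod.stdAddChar (-(∑ i : Fin m, t i * u i)) : ℂ) * S u‖
      ≤ 200 / 39 * (39 / 40 : ℝ) ^ A.card * (2 : ℝ) ^ (N - 1) := by
    intro u
    rw [norm_mul, AffBells21.norm_stdAddChar_three, one_mul]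
    exact norm_twist_sum_le_junta hN T (fun k => τ k u) (fun k => hτ k u) γ A hA hAγ
  rw [hexp, norm_mul, norm_inv, norm_pow]
  have h3 : ‖(3 : ℂ)‖ = 3 := by simp
  rw [h3]
  calc ((3 : ℝ) ^ m)⁻¹ * ‖∑ u : Fin m → ZMod 3, (ZMod.stdAddChar (-(∑ i : Fin m, t i * u i)) : ℂ) * S u‖
      ≤ ((3 : ℝ) ^ m)⁻¹ * ∑ u : Fin m → ZMod 3, ‖(ZMod.stdAddChar (-(∑ i : Fin m, t i * u i)) : ℂ) * S u‖ := by
        gcongr; exact norm_sum_le _ _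
    _ ≤ ((3 : ℝ) ^ m)⁻¹ * ∑ _u : Fin m → ZMod 3, (200 / 39 * (39 / 40 : ℝ) ^ A.card * (2 : ℝ) ^ (N - 1)) := by
        gcongr with u _; exact hin u
    _ = 200 / 39 * (39 / 40 : ℝ) ^ A.card * (2 : ℝ) ^ (N - 1) := by
        rw [sum_const, card_univ, card_frame, nsmul_eq_mul]
        push_cast
        field_simp

/-! ## Frame averaging for all junta widths -/

/-- A transversal of the reading sets inside `supp(tV)` of size `≥ δ²N/(δ + w₀²)` (Turán / Caro–Wei, `AffBells23.exists_transversal_ge`). -/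
theorem exists_frame_transversal (hN : 0 < N) (V : Fin m → Fin N → ZMod 3) (T : Fin N → Finset (Fin N)) {w₀ : ℕ}
    (hT : ∀ k, (T k).card ≤ w₀) {δ : ℝ} (hδ : 0 < δ) (t : Fin m → ZMod 3)
    (hreg : δ * N ≤ ((univ.filter fun i : Fin N => (∑ l : Fin m, t l * V l i) ≠ 0).card : ℝ)) :
    ∃ A : Finset (Fin N), (∀ k, (T k ∩ A).card ≤ 1) ∧ (∀ i ∈ A, (∑ l : Fin m, t l * V l i) ≠ 0) ∧
      δ ^ 2 / (δ + (w₀ : ℝ) ^ 2) * N ≤ (A.card : ℝ) := by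
  set P := univ.filter fun i : Fin N => (∑ l : Fin m, t l * V l i) ≠ 0 with hP
  have hΛ : (∑ k ∈ (univ : Finset (Fin N)), ((T k).card : ℝ) * (((T k).card : ℝ) - 1)) ≤ N * (w₀ : ℝ) ^ 2 := by
    calc (∑ k ∈ (univ : Finset (Fin N)), ((T k).card : ℝ) * (((T k).card : ℝ) - 1))
        ≤ ∑ _k ∈ (univ : Finset (Fin N)), (w₀ : ℝ) ^ 2 := by
          refine sum_le_sum fun k _ => ?_
          have h1 : ((T k).card : ℝ) ≤ w₀ := by exact_mod_cast hT k
          have h0 : (0 : ℝ) ≤ (T k).card := by positivity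
          nlinarith
      _ = N * (w₀ : ℝ) ^ 2 := by rw [sum_const, card_univ, Fintype.card_fin, nsmul_eq_mul]
  obtain ⟨A, hAP, htr, hsize⟩ := AffBells23.exists_transversal_ge (univ : Finset (Fin N)) T P (w := δ * N)
    (by positivity) hreg hΛ
  refine ⟨A, fun k => htr k (mem_univ k), fun i hi => (mem_filter.mp (hAP hi)).2, le_trans (le_of_eq ?_) hsize⟩
  have hN' : (0 : ℝ) < N := by exact_mod_cast hN
  field_simp

/-- **FRAME AVERAGING FOR ALL JUNTA WIDTHS** (Sketch22 §2c `FrameAveraging`): a frame ⊗ `w₀`-junta strategy over a `δ`-regular frame of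
dimension `m ≤ μ₀N` wins at most `ε·2^{N−1}` more often than the average of its `3^m` frozen strategies; `μ₀ = δ'·log(40/39)/(2 log 3)`,
`δ' = δ²/(δ + w₀²)`.  Proof: as `frameAveragingOne`, with LEMMA JPD (`AffBells23JuntaProduct`, planner qn-p1 g23) on the fibres and a
Turán transversal of the reading sets inside `supp(tV)` — NO Viola–Wigderson / `Mod3VsLowDegree` input. -/
theorem frameAveraging : FrameAveraging := by
  intro δ hδ w₀ ε hε
  have hlog : 0 < Real.log (40 / 39) := Real.log_pos (by norm_num)
  have hlog3 : 0 < Real.log 3 := Real.log_pos (by norm_num)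
  set δ' : ℝ := δ ^ 2 / (δ + (w₀ : ℝ) ^ 2) with hδ'
  have hδ'0 : 0 < δ' := by positivity
  set a : ℝ := δ' * Real.log (40 / 39) / 2 with ha
  have ha0 : 0 < a := by positivity
  refine ⟨a / Real.log 3, by positivity, max 3 ⌈(100 / 39) / (ε * a)⌉₊, fun N hN m hm V T τ hV hT hτ => ?_⟩
  have hN3 : 3 ≤ N := le_trans (le_max_left _ _) hN
  have hNceil : (100 / 39) / (ε * a) ≤ N :=
    le_trans (Nat.le_ceil _) (by exact_mod_cast le_trans (le_max_right _ _) hN)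
  refine (frame_domination hN3 V τ).trans (add_le_add le_rfl ?_)
  have hterm : ∀ t ∈ (univ : Finset (Fin m → ZMod 3)).erase 0,
      ‖∑ x ∈ (univ : Finset (Fin N → Bool)).filter (fun x => Fib19.IsOdd x),
          fhat m (frozenSign τ x) t * (ZMod.stdAddChar (∑ l : Fin m, t l * frameVal V x l) : ℂ)‖
        ≤ 200 / 39 * Real.exp (-(2 * a * N)) * (2 : ℝ) ^ (N - 1) := by
    intro t ht
    have ht0 : t ≠ 0 := (mem_erase.mp ht).1
    obtain ⟨A, hA, hAγ, hsize⟩ := exists_frame_transversal (by omega) V T hT hδ t (hV t ht0)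
    refine (norm_errorTerm_le_junta hN3 V T τ hτ t A hA hAγ).trans ?_
    have hk : (39 / 40 : ℝ) ^ A.card ≤ Real.exp (-(2 * a * N)) := by
      rw [← Real.exp_log (show (0 : ℝ) < 39 / 40 by norm_num), ← Real.exp_nat_mul, Real.exp_le_exp]
      have hl : Real.log (39 / 40) = -Real.log (40 / 39) := by
        rw [← Real.log_inv]; norm_num
      rw [hl, ha]
      have := mul_le_mul_of_nonneg_right hsize hlog.le
      linarith
    gcongr
  have hcard : (((univ : Finset (Fin m → ZMod 3)).erase 0).card : ℝ) ≤ (3 : ℝ) ^ m := by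
    have h : ((univ : Finset (Fin m → ZMod 3)).erase 0).card ≤ 3 ^ m := by
      rw [card_erase_of_mem (mem_univ _), card_univ, card_frame]; exact Nat.sub_le _ _
    exact_mod_cast h
  have h3m : (3 : ℝ) ^ m ≤ Real.exp (a * N) := by
    have : (3 : ℝ) ^ m = Real.exp (m * Real.log 3) := by rw [Real.exp_nat_mul, Real.exp_log (by norm_num)]
    rw [this, Real.exp_le_exp]
    calc (m : ℝ) * Real.log 3 ≤ a / Real.log 3 * N * Real.log 3 := mul_le_mul_of_nonneg_right hm hlog3.le
      _ = a * N := by field_simp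
  have hfin : 100 / 39 * Real.exp (-(a * N)) ≤ ε := by
    have h1 := exp_neg_le_one_div (s := a * N) (by positivity)
    have h2 : 100 / 39 ≤ ε * a * N := by
      rw [div_le_iff₀ (by positivity)] at hNceil; linarith
    calc 100 / 39 * Real.exp (-(a * N)) ≤ 100 / 39 * (1 / (a * N + 1)) := by gcongr
      _ ≤ ε := by
          rw [← mul_div_assoc, mul_one, div_le_iff₀ (by positivity)]
          nlinarith [hε.le]
  have h2N : (0 : ℝ) ≤ (2 : ℝ) ^ (N - 1) := by positivity
  calc (1 / 2 : ℝ) * ∑ t ∈ (univ : Finset (Fin m → ZMod 3)).erase 0,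
          ‖∑ x ∈ (univ : Finset (Fin N → Bool)).filter (fun x => Fib19.IsOdd x),
            fhat m (frozenSign τ x) t * (ZMod.stdAddChar (∑ l : Fin m, t l * frameVal V x l) : ℂ)‖
      ≤ (1 / 2 : ℝ) * ∑ _t ∈ (univ : Finset (Fin m → ZMod 3)).erase 0,
          (200 / 39 * Real.exp (-(2 * a * N)) * (2 : ℝ) ^ (N - 1)) :=
        mul_le_mul_of_nonneg_left (sum_le_sum hterm) (by norm_num)
    _ = (1 / 2 : ℝ) * ((((univ : Finset (Fin m → ZMod 3)).erase 0).card : ℝ)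
          * (200 / 39 * Real.exp (-(2 * a * N)) * (2 : ℝ) ^ (N - 1))) := by rw [sum_const, nsmul_eq_mul]
    _ ≤ (1 / 2 : ℝ) * ((3 : ℝ) ^ m * (200 / 39 * Real.exp (-(2 * a * N)) * (2 : ℝ) ^ (N - 1))) := by gcongr
    _ ≤ (1 / 2 : ℝ) * (Real.exp (a * N) * (200 / 39 * Real.exp (-(2 * a * N)) * (2 : ℝ) ^ (N - 1))) := by gcongr
    _ = 100 / 39 * (Real.exp (a * N) * Real.exp (-(2 * a * N))) * (2 : ℝ) ^ (N - 1) := by ring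
    _ = 100 / 39 * Real.exp (-(a * N)) * (2 : ℝ) ^ (N - 1) := by
        rw [← Real.exp_add]; congr 2; ring_nf
    _ ≤ ε * (2 : ℝ) ^ (N - 1) := mul_le_mul_of_nonneg_right hfin h2N

/-- **RUNG `RingFrameJuntaLt3` (R-frame ⊗ junta) PROVED**, unconditionally: frame averaging (`frameAveraging`) + junta hardness
(`juntaHardOfTwo`) + the tree theorem `ringHardOdd_two`, via the landed bookkeeping `ringFrameJuntaLt3_of`. -/
theorem ringFrameJuntaLt3 : RingFrameJuntaLt3 := ringFrameJuntaLt3_of frameAveraging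

/-- Hence also `FrameJuntaOfCommon`'s target and `FrameJuntaOfAveraging`'s conclusion hold outright (for the record). -/
theorem frameJunta_rungs : FrameAveraging ∧ RingFrameJuntaLt3 ∧ RingFrameAffineLt3 :=
  ⟨frameAveraging, ringFrameJuntaLt3, ringFrameAffineLt3⟩

end AffBells22

end Summit.QuantumAdvantage.AdviceFreeQNC0
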